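import Summits.CriticalPhenomena.PercolationContinuityZ3.Theorems.Transplant.FKThreeApexRigid
import Summits.CriticalPhenomena.PercolationContinuityZ3.Theorems.Transplant.FKConnectivityAllQRigidInterpolation
import Summits.CriticalPhenomena.PercolationContinuityZ3.Theorems.Transplant.FKConnectivityAllQEdgeMono
import HarnessLib

/-!
# Connectivity correlation inequalities for `φ_{w,q}` — the three-apex family: the TRANSFER FORMULA `Z_w = val(M(z_n)⋯M(z_1)δ_0)` for `K_{3,n}`

Support file (`--supports stmt-CriticalPhenomena-4575`), FK sub-lane `prim-bschramm-fk-3` (gen 12); builds on p205010 (kernel theorem, internal audit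
signed; external expert review pending).  No named facts, no sorries; standard axioms.  Layer 2b of the `K_{1,1,1,n}` programme (memo
`bschramm/prim-bschramm-fk-3/THREE-APEX.md` §6): for three distinct apices `a, b, c`, leaves `v 0, …, v (n-1)` exhausting the other vertices, and a
weight vector `w` supported on the apex–leaf pairs (the graph `K_{3,n}`), the random-cluster partition function is the `q^{|π|}`-valuation of the
product of the leaf letters of `…ThreeApexAlgebra`: **`rcPartitionFunctionW_eq_transfer3`**.  PROOF by rigid interpolation (`FK.eq_of_affine_of_rigid`):
both sides are affine in every pair parameter (`rcPartitionFunctionW_affine`; `transfer3_affine`, the letters being affine in each probability and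
the letter action linear), and at a rigid `w` the left side is `q^{k(ω_w)}` (`FK.rcPartitionFunctionW_rigid_eq_pow`) while the right side is
`q^{blocks + #unattached}` (`val_zvecB`), equal by the cluster-count invariant `conf_inv` (`…ThreeApexClusterCount`).
[cite: Grimmett2006, §1.4 eq. (1.20) (p. 15)] [folklore]
-/

noncomputable section

namespace Summit.CriticalPhenomena.PercolationContinuityZ3.Theorems

namespace FK

namespace ThreeApex

open Literature.Probability.LatticeModels Literature.Probability.Percolation
open scoped Classical

variable {V : Type*} [Fintype V]

/-- The apex–leaf pairs of `K_{3,n}`. [folklore] -/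
def apexPairs (a b c : V) (v : ℕ → V) (n : ℕ) : Finset (Sym2 V) :=
  (Finset.range n).biUnion fun j => {s(a, v j), s(b, v j), s(c, v j)}

/-- The letter of the leaf `u` read off the weight vector. [folklore] -/
def leafOf (q : ℝ) (w : Sym2 V → unitInterval) (a b c u : V) : V5 :=
  leaf q ((w s(a, u) : unitInterval) : ℝ) ((w s(b, u) : unitInterval) : ℝ) ((w s(c, u) : unitInterval) : ℝ)

/-- The product of the first `i` leaf letters applied to `δ_0`. [folklore] -/
def zvec (q : ℝ) (w : Sym2 V → unitInterval) (a b c : V) (v : ℕ → V) : ℕ → V5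
  | 0 => delta0
  | i + 1 => conv (leafOf q w a b c (v i)) (zvec q w a b c v i)

/-- The transfer expression: the `q^{|π|}`-valuation of the letter product. [folklore] -/
def transfer3 (q : ℝ) (w : Sym2 V → unitInterval) (a b c : V) (v : ℕ → V) (n : ℕ) : ℝ := val q (zvec q w a b c v n)

/-! ### Affine combinations of five-vectors -/

/-- `Zt = (1−t)Z0 + tZ1` componentwise. [folklore] -/
structure AffC (t : ℝ) (Zt Z0 Z1 : V5) : Prop where
  /-- component `0̂` -/
  h0 : Zt.z0 = (1 - t) * Z0.z0 + t * Z1.z0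
  /-- component `ab` -/
  hab : Zt.zab = (1 - t) * Z0.zab + t * Z1.zab
  /-- component `ac` -/
  hac : Zt.zac = (1 - t) * Z0.zac + t * Z1.zac
  /-- component `bc` -/
  hbc : Zt.zbc = (1 - t) * Z0.zbc + t * Z1.zbc
  /-- component `1̂` -/
  h1 : Zt.z1 = (1 - t) * Z0.z1 + t * Z1.z1

/-- The letter action is linear in the vector. [folklore] -/
theorem AffC.conv_right {t : ℝ} {Zt Z0 Z1 : V5} (L : V5) (h : AffC t Zt Z0 Z1) :
    AffC t (conv L Zt) (conv L Z0) (conv L Z1) := by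
  obtain ⟨h0, h1, h2, h3, h4⟩ := h
  refine ⟨?_, ?_, ?_, ?_, ?_⟩ <;> simp only [conv, V5.total, h0, h1, h2, h3, h4] <;> ring

/-- The letter of a leaf is affine in its first probability (and the action is linear in the letter). [folklore] -/
theorem affC_conv_leaf₁ (q t y z : ℝ) (Z : V5) : AffC t (conv (leaf q t y z) Z) (conv (leaf q 0 y z) Z) (conv (leaf q 1 y z) Z) := by
  refine ⟨?_, ?_, ?_, ?_, ?_⟩ <;> simp only [conv, leaf, V5.total] <;> ring

/-- … in its second probability. [folklore] -/
theorem affC_conv_leaf₂ (q x t z : ℝ) (Z : V5) : AffC t (conv (leaf q x t z) Z) (conv (leaf q x 0 z) Z) (conv (leaf q x 1 z) Z) := by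
  refine ⟨?_, ?_, ?_, ?_, ?_⟩ <;> simp only [conv, leaf, V5.total] <;> ring

/-- … in its third probability. [folklore] -/
theorem affC_conv_leaf₃ (q x y t : ℝ) (Z : V5) : AffC t (conv (leaf q x y t) Z) (conv (leaf q x y 0) Z) (conv (leaf q x y 1) Z) := by
  refine ⟨?_, ?_, ?_, ?_, ?_⟩ <;> simp only [conv, leaf, V5.total] <;> ring

/-- The valuation is linear. [folklore] -/
theorem AffC.val_eq {t : ℝ} {Zt Z0 Z1 : V5} (q : ℝ) (h : AffC t Zt Z0 Z1) : val q Zt = (1 - t) * val q Z0 + t * val q Z1 := by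
  obtain ⟨h0, h1, h2, h3, h4⟩ := h
  simp only [val, h0, h1, h2, h3, h4]; ring

section Setting

variable {a b c : V} {v : ℕ → V} {n : ℕ}
variable (hab : a ≠ b) (hac : a ≠ c) (hbc : b ≠ c) (hinj : ∀ j k, j < n → k < n → v j = v k → j = k)
  (hva : ∀ j, j < n → v j ≠ a) (hvb : ∀ j, j < n → v j ≠ b) (hvc : ∀ j, j < n → v j ≠ c)
include hab hac hbc hinj hva hvb hvc

omit [Fintype V] hab hac hbc in
/-- Pairs at different leaves differ. [folklore] -/
theorem pair_ne_of_ne {x y : V} (hx : x = a ∨ x = b ∨ x = c) {j k : ℕ} (hj : j < n) (hk : k < n)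
    (hjk : j ≠ k) : s(x, v j) ≠ s(y, v k) := by
  intro h
  rcases Sym2.eq_iff.1 h with ⟨_, h2⟩ | ⟨h1, _⟩
  · exact hjk (hinj j k hj hk h2)
  · rcases hx with rfl | rfl | rfl
    · exact hva k hk h1.symm
    · exact hvb k hk h1.symm
    · exact hvc k hk h1.symm

omit [Fintype V] hinj hvc in
/-- The three pairs at one leaf differ. [folklore] -/
theorem pairs_at_leaf_ne {j : ℕ} (hj : j < n) :
    s(a, v j) ≠ s(b, v j) ∧ s(a, v j) ≠ s(c, v j) ∧ s(b, v j) ≠ s(c, v j) := by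
  refine ⟨fun h => ?_, fun h => ?_, fun h => ?_⟩
  · rcases Sym2.eq_iff.1 h with ⟨h1, _⟩ | ⟨h1, _⟩
    · exact hab h1
    · exact hva j hj h1.symm
  · rcases Sym2.eq_iff.1 h with ⟨h1, _⟩ | ⟨h1, _⟩
    · exact hac h1
    · exact hva j hj h1.symm
  · rcases Sym2.eq_iff.1 h with ⟨h1, _⟩ | ⟨h1, _⟩
    · exact hbc h1
    · exact hvb j hj h1.symm

omit [Fintype V] hab hac hbc in
/-- Updating a pair at leaf `j₀` does not change the letters of the other leaves. [folklore] -/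
theorem leafOf_update_of_ne (q : ℝ) (w : Sym2 V → unitInterval) (x : V) {j₀ j : ℕ}
    (hj₀ : j₀ < n) (hj : j < n) (hne : j ≠ j₀) (s : unitInterval) :
    leafOf q (Function.update w s(x, v j₀) s) a b c (v j) = leafOf q w a b c (v j) := by
  have ha' := pair_ne_of_ne hinj hva hvb hvc (x := a) (y := x) (Or.inl rfl) hj hj₀ hne
  have hb' := pair_ne_of_ne hinj hva hvb hvc (x := b) (y := x) (Or.inr (Or.inl rfl)) hj hj₀ hne
  have hc' := pair_ne_of_ne hinj hva hvb hvc (x := c) (y := x) (Or.inr (Or.inr rfl)) hj hj₀ hne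
  simp only [leafOf, Function.update_of_ne ha', Function.update_of_ne hb', Function.update_of_ne hc']

omit [Fintype V] hab hac hbc in
/-- … hence not the letter product below `j₀`. [folklore] -/
theorem zvec_update_of_le (q : ℝ) (w : Sym2 V → unitInterval) (x : V) {j₀ : ℕ} (hj₀ : j₀ < n)
    (s : unitInterval) : ∀ i, i ≤ j₀ → zvec q (Function.update w s(x, v j₀) s) a b c v i = zvec q w a b c v i := by
  intro i
  induction i with
  | zero => intro; rfl
  | succ i ih =>
    intro hi
    have hin : i < n := by omega
    have hne : i ≠ j₀ := by omega
    simp only [zvec, ih (by omega), leafOf_update_of_ne hinj hva hvb hvc q w x hj₀ hin hne s]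

omit [Fintype V] in
/-- **The transfer expression is affine in every apex–leaf pair parameter.** [folklore] -/
theorem transfer3_update_affine (q : ℝ) (w : Sym2 V → unitInterval) {x : V} (hx : x = a ∨ x = b ∨ x = c) {j₀ : ℕ} (hj₀ : j₀ < n)
    (t : unitInterval) :
    transfer3 q (Function.update w s(x, v j₀) t) a b c v n =
      (1 - (t : ℝ)) * transfer3 q (Function.update w s(x, v j₀) 0) a b c v n +
        (t : ℝ) * transfer3 q (Function.update w s(x, v j₀) 1) a b c v n := by
  -- the letters above `j₀` are common; the letter at `j₀` is affine in `t`; below `j₀` nothing changes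
  have key : ∀ k, j₀ + 1 + k ≤ n →
      AffC (t : ℝ) (zvec q (Function.update w s(x, v j₀) t) a b c v (j₀ + 1 + k))
        (zvec q (Function.update w s(x, v j₀) 0) a b c v (j₀ + 1 + k))
        (zvec q (Function.update w s(x, v j₀) 1) a b c v (j₀ + 1 + k)) := by
    intro k
    induction k with
    | zero =>
      intro _
      simp only [zvec, zvec_update_of_le hinj hva hvb hvc q w x hj₀ _ j₀ le_rfl]
      obtain ⟨nab, nac, nbc⟩ := pairs_at_leaf_ne hab hac hbc hva hvb hj₀
      rcases hx with rfl | rfl | rfl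
      · simp only [leafOf, Function.update_self, Function.update_of_ne nab.symm, Function.update_of_ne nac.symm]
        exact affC_conv_leaf₁ q _ _ _ _
      · simp only [leafOf, Function.update_self, Function.update_of_ne nab, Function.update_of_ne nbc.symm]
        exact affC_conv_leaf₂ q _ _ _ _
      · simp only [leafOf, Function.update_self, Function.update_of_ne nac, Function.update_of_ne nbc]
        exact affC_conv_leaf₃ q _ _ _ _
    | succ k ih =>
      intro hk
      have e : j₀ + 1 + (k + 1) = (j₀ + 1 + k) + 1 := by omega
      rw [e]
      simp only [zvec]
      have hne : j₀ + 1 + k ≠ j₀ := by omega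
      have hkn : j₀ + 1 + k < n := by omega
      rw [leafOf_update_of_ne hinj hva hvb hvc q w x hj₀ hkn hne t,
        leafOf_update_of_ne hinj hva hvb hvc q w x hj₀ hkn hne 0,
        leafOf_update_of_ne hinj hva hvb hvc q w x hj₀ hkn hne 1]
      exact (ih (by omega)).conv_right _
  have h := (key (n - (j₀ + 1)) (by omega)).val_eq q
  rw [show j₀ + 1 + (n - (j₀ + 1)) = n by omega] at h
  exact h

omit [Fintype V] hab hac hbc hinj hva hvb hvc in
/-- Membership in `apexPairs`. [folklore] -/
theorem mem_apexPairs_iff (e : Sym2 V) :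
    e ∈ apexPairs a b c v n ↔ ∃ j, j < n ∧ (e = s(a, v j) ∨ e = s(b, v j) ∨ e = s(c, v j)) := by
  simp [apexPairs]

omit [Fintype V] in
/-- **Affinity on the apex–leaf pairs** in the form required by `FK.eq_of_affine_of_rigid`. [folklore] -/
theorem transfer3_affine (q : ℝ) (w : Sym2 V → unitInterval) {e : Sym2 V} (he : e ∈ apexPairs a b c v n) :
    transfer3 q w a b c v n = (1 - ((w e : unitInterval) : ℝ)) * transfer3 q (Function.update w e 0) a b c v n +
      ((w e : unitInterval) : ℝ) * transfer3 q (Function.update w e 1) a b c v n := by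
  obtain ⟨j₀, hj₀, hx⟩ := (mem_apexPairs_iff e).1 he
  have main : ∀ x : V, (x = a ∨ x = b ∨ x = c) → e = s(x, v j₀) →
      transfer3 q w a b c v n = (1 - ((w e : unitInterval) : ℝ)) * transfer3 q (Function.update w e 0) a b c v n +
        ((w e : unitInterval) : ℝ) * transfer3 q (Function.update w e 1) a b c v n := by
    rintro x hx' rfl
    have h := transfer3_update_affine hab hac hbc hinj hva hvb hvc q w hx' hj₀ (w s(x, v j₀))
    rwa [Function.update_eq_self] at h
  rcases hx with h | h | h
  · exact main a (Or.inl rfl) h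
  · exact main b (Or.inr (Or.inl rfl)) h
  · exact main c (Or.inr (Or.inr rfl)) h

/-! ### The rigid case -/

omit [Fintype V] hab hac hbc hinj hva hvb hvc in
/-- Membership in `star`. [folklore] -/
theorem mem_star_iff (u : V) (A : Finset V) (e : Sym2 V) : e ∈ star u A ↔ ∃ x ∈ A, e = s(x, u) := by
  simp only [star, Finset.mem_image]
  constructor
  · rintro ⟨x, hx, rfl⟩; exact ⟨x, hx, rfl⟩
  · rintro ⟨x, hx, rfl⟩; exact ⟨x, hx, rfl⟩

omit [Fintype V] hab hac hbc hinj hva hvb hvc in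
/-- Membership in `conf` started from `∅`. [folklore] -/
theorem mem_conf_empty_iff (att : ℕ → Bool × Bool × Bool) (e : Sym2 V) :
    ∀ i, e ∈ conf a b c v att ∅ i ↔ ∃ j, j < i ∧ e ∈ star (v j) (attFin a b c (att j).1 (att j).2.1 (att j).2.2) := by
  intro i
  induction i with
  | zero => simp [conf]
  | succ i ih =>
    simp only [conf, Finset.mem_union, ih]
    constructor
    · rintro (⟨j, hj, h⟩ | h)
      · exact ⟨j, by omega, h⟩
      · exact ⟨i, by omega, h⟩
    · rintro ⟨j, hj, h⟩
      rcases Nat.lt_succ_iff_lt_or_eq.1 hj with hj' | rfl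
      · exact Or.inl ⟨j, hj', h⟩
      · exact Or.inr h

/-- **The transfer formula at a rigid weight vector.** [cite: Grimmett2006, §1.4 eq. (1.20) (p. 15)] -/
theorem rcPartitionFunctionW_eq_transfer3_rigid (hcard : Fintype.card V = n + 3) (q : ℝ) (w : Sym2 V → unitInterval)
    (hsupp : ∀ e, e ∉ apexPairs a b c v n → w e = 0)
    (hrig : ∀ e ∈ apexPairs a b c v n, ((w e : unitInterval) : ℝ) = 0 ∨ ((w e : unitInterval) : ℝ) = 1) :
    rcPartitionFunctionW w q ∅ = transfer3 q w a b c v n := by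
  have hR : ∀ e : Sym2 V, ((w e : unitInterval) : ℝ) = 0 ∨ ((w e : unitInterval) : ℝ) = 1 := by
    intro e
    by_cases he : e ∈ apexPairs a b c v n
    · exact hrig e he
    · left; rw [hsupp e he]; rfl
  -- Boolean attachment data
  set att : ℕ → Bool × Bool × Bool := fun j =>
    (decide (((w s(a, v j) : unitInterval) : ℝ) = 1), decide (((w s(b, v j) : unitInterval) : ℝ) = 1),
      decide (((w s(c, v j) : unitInterval) : ℝ) = 1)) with hatt
  have hbR : ∀ e : Sym2 V, ((w e : unitInterval) : ℝ) = bR (decide (((w e : unitInterval) : ℝ) = 1)) := by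
    intro e
    rcases hR e with h | h
    · rw [h]; simp [bR]
    · rw [h]; simp [bR]
  -- the right-hand side: the rigid letter product
  have hz : ∀ i, zvec q w a b c v i = zvecB q att .bot i := by
    intro i
    induction i with
    | zero => simp [zvec, zvecB, delta0_eq_basisVec]
    | succ i ih =>
      have hl : leafOf q w a b c (v i) = leafB q (att i).1 (att i).2.1 (att i).2.2 := by
        unfold leafOf leafB
        congr 1
        · exact hbR _
        · exact hbR _
        · exact hbR _
      rw [zvec, zvecB, ih, hl]
  have hrhs : transfer3 q w a b c v n = q ^ ((apexState att .bot n).blocks + (n - attached att n)) := by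
    rw [transfer3, hz, val_zvecB]
  -- the left-hand side: the rigid configuration is `conf n`
  have hconf : {e : Sym2 V | ((w e : unitInterval) : ℝ) = 1} = ↑(conf a b c v att ∅ n) := by
    ext e
    simp only [Set.mem_setOf_eq, Finset.mem_coe, mem_conf_empty_iff, mem_star_iff, exists_mem_attFin]
    constructor
    · intro h1
      have hne : w e ≠ 0 := by
        intro h0; rw [h0] at h1; norm_num at h1
      have he : e ∈ apexPairs a b c v n := by
        by_contra hc; exact hne (hsupp e hc)
      obtain ⟨j, hj, hx⟩ := (mem_apexPairs_iff e).1 he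
      refine ⟨j, hj, ?_⟩
      rcases hx with rfl | rfl | rfl
      · exact Or.inl ⟨by simp only [hatt, decide_eq_true_eq]; exact h1, rfl⟩
      · exact Or.inr (Or.inl ⟨by simp only [hatt, decide_eq_true_eq]; exact h1, rfl⟩)
      · exact Or.inr (Or.inr ⟨by simp only [hatt, decide_eq_true_eq]; exact h1, rfl⟩)
    · rintro ⟨j, _, (⟨h, rfl⟩ | ⟨h, rfl⟩ | ⟨h, rfl⟩)⟩
      · simp only [hatt, decide_eq_true_eq] at h; exact h
      · simp only [hatt, decide_eq_true_eq] at h; exact h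
      · simp only [hatt, decide_eq_true_eq] at h; exact h
  -- cluster count from the invariant
  have h0 : ∀ y z : V, y ≠ z → ¬ (openGraph (↑(∅ : Finset (Sym2 V)) : BondConfig V)).Reachable y z :=
    fun y z hyz => fun h => Wheel.not_reachable_of_fresh (ω := ∅) (u := z) (by simp) hyz h
  have hinv := conf_inv a b c v att ∅ P3.bot n hinj hva hvb hvc (by simp)
    (by rw [show P3.rAB P3.bot = false from rfl]; simp only [Bool.false_eq_true, iff_false]; exact h0 a b hab)
    (by rw [show P3.rAC P3.bot = false from rfl]; simp only [Bool.false_eq_true, iff_false]; exact h0 a c hac)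
    (by rw [show P3.rBC P3.bot = false from rfl]; simp only [Bool.false_eq_true, iff_false]; exact h0 b c hbc) n le_rfl
  obtain ⟨hk, -, -, -, -⟩ := hinv
  rw [Wheel.clusterCount_emptyFinset, hcard, show P3.blocks P3.bot = 3 from rfl] at hk
  have hatt_le := attached_le att n
  rw [rcPartitionFunctionW_rigid_eq_pow w q hR, hconf, hrhs]
  congr 1
  omega

/-- **TRANSFER FORMULA for `K_{3,n}`.**  Three distinct apices `a, b, c`, leaves `v 0, …, v (n−1)` (pairwise distinct, not apices) exhausting
`V` (`card V = n + 3`), `w` supported on the apex–leaf pairs: `Z_w = val_q(M(z_{n-1}) ⋯ M(z_0) δ_0)` with `z_j = leaf q (w a v_j) (w b v_j) (w c v_j)`.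
[cite: Grimmett2006, §1.4 eq. (1.20) (p. 15)] -/
theorem rcPartitionFunctionW_eq_transfer3 (hcard : Fintype.card V = n + 3) (q : ℝ) (w : Sym2 V → unitInterval)
    (hsupp : ∀ e, e ∉ apexPairs a b c v n → w e = 0) :
    rcPartitionFunctionW w q ∅ = transfer3 q w a b c v n :=
  eq_of_affine_of_rigid (apexPairs a b c v n) (fun u => rcPartitionFunctionW u q ∅) (fun u => transfer3 q u a b c v n)
    (fun u _ e _ => rcPartitionFunctionW_affine u q e)
    (fun u _ _ he => transfer3_affine hab hac hbc hinj hva hvb hvc q u he)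
    (fun u hu hr => rcPartitionFunctionW_eq_transfer3_rigid hab hac hbc hinj hva hvb hvc hcard q u hu hr) w hsupp

end Setting

end ThreeApex

end FK

end Summit.CriticalPhenomena.PercolationContinuityZ3.Theorems
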